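import Literature.GroupTheory.CombinatorialGroupTheory.PuncturedSurfaceGroupCuspQuotients
import Literature.GroupTheory.CombinatorialGroupTheory.PuncturedSurfaceGroupCusps
import HarnessLib

/-!
# Finite quotients of `Γ_{g,r}` killing some cusps and giving the others a prescribed order

For the punctured surface group
`Γ_{g,r} = ⟨a₁, b₁, …, a_g, b_g, c₁, …, c_r ∣ [a₁,b₁]⋯[a_g,b_g]·c₁⋯c_r⟩`, an integer `n ≥ 1` and two
disjoint sets of cusps `Z` ("to be killed") and `R` ("to be ramified of index exactly `n`"), there is
a normal subgroup `N ⊴ Γ_{g,r}` of index dividing `n ^ 3` with `c_j ∈ N` for `j ∈ Z` and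
`N ∩ ⟨c_j⟩ = ⟨c_j ^ n⟩` for `j ∈ R` (`exists_normal_mixed`) — UNLESS `g = 0`, `R` is a single cusp and
`Z ∪ R` is the set of all cusps: in that case (and, for `g = 0`, whenever at most one cusp is left
out of `Z`) every subgroup containing the `c_j`, `j ∈ Z`, contains all the `c_j`
(`mem_of_forall_ne_mem`: on a sphere one cannot ramify at a single point).  Constructions: abelian
targets `(ℤ/n)²` with cusp values summing to zero (`exists_hom_of_values`), and for a single
ramified cusp in positive genus the Heisenberg group mod `n` (`exists_hom_single_cusp`, the
construction of `exists_hom_of_one` with the other cusps killed).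

This is the group-theoretic core of the "mixed" finite étale coverings of the semi-graph of
anabelioids of a pointed stable curve — trivial over one node, ramified over another — used for
[SemiAnbd] Remark 2.10.1 (`C_{Π_𝒢}(Π_b) = Π_b` for `𝒢` of surface type, "using exactly the same
techniques as … Proposition 2.6, Corollary 2.7") [cite: MochizukiSemiAnbd2006, Rem. 2.10.1 p.32];
cell abc-iut, layer L3, row F-1477, seat abc-iut-L3-t12.  Theorems only; no statement here takes a
side on any disputed claim.
-/

namespace Literature.GroupTheory.CombinatorialGroupTheory.PuncturedSurfaceGroup

open Multiplicative

variable {g r : ℕ}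

/-! ### Homomorphisms to abelian groups with prescribed cusp values -/

/-- **Abelian quotients with prescribed cusp values.** For an additive commutative group `A` and
values `v : Fin r → A` with `∑ⱼ v j = 0` there is a homomorphism `Γ_{g,r} → A` (written
multiplicatively) with `c_j ↦ v j` and `aᵢ, bᵢ ↦ 0`. [cite: MochizukiSemiAnbd2006, Ex. 2.10 p.31] -/
theorem exists_hom_of_values {A : Type*} [AddCommGroup A] (v : Fin r → A)
    (hv : ∑ j, v j = 0) :
    ∃ φ : PuncturedSurfaceGroup g r →* Multiplicative A, ∀ j, φ (c j) = ofAdd (v j) := by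
  classical
  let F : puncturedSurfaceGen g r → Multiplicative A := Sum.elim (fun _ => 1) fun j => ofAdd (v j)
  have hrel : ∀ w ∈ ({relator g r} : Set (FreeGroup (puncturedSurfaceGen g r))),
      FreeGroup.lift F w = 1 := by
    intro w hw
    rw [Set.mem_singleton_iff] at hw
    subst hw
    rw [lift_relator]
    have h1 : ((List.finRange g).map fun i =>
        F (Sum.inl (i, false)) * F (Sum.inl (i, true)) * (F (Sum.inl (i, false)))⁻¹ *
          (F (Sum.inl (i, true)))⁻¹).prod = 1 :=
      List.prod_eq_one fun y hy => by
        obtain ⟨i, -, rfl⟩ := List.mem_map.mp hy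
        simp [F]
    have h2 : ((List.finRange r).map fun j => F (Sum.inr j)).prod = 1 := by
      rw [← Fin.prod_univ_def]
      simp only [F, Sum.elim_inr]
      rw [← ofAdd_sum, hv, ofAdd_zero]
    rw [h1, h2, one_mul]
  refine ⟨PresentedGroup.toGroup hrel, fun j => ?_⟩
  rw [c, PresentedGroup.toGroup.of]
  rfl

/-! ### A single ramified cusp in positive genus: the Heisenberg group mod `n` -/

/-- A list product all of whose factors are `1` except the one at a given (non-repeated) entry.
[folklore] -/
private theorem prod_map_ite_eq_of_nodup {ι M : Type*} [DecidableEq ι] [Monoid M] (L : List ι)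
    (hL : L.Nodup) (j₀ : ι) (hj₀ : j₀ ∈ L) (x : M) :
    (L.map fun j => if j = j₀ then x else 1).prod = x := by
  induction L with
  | nil => simp at hj₀
  | cons hd tl ih =>
    rw [List.map_cons, List.prod_cons]
    rw [List.nodup_cons] at hL
    by_cases hhd : hd = j₀
    · subst hhd
      rw [if_pos rfl]
      have : (tl.map fun j => if j = hd then x else 1).prod = 1 :=
        List.prod_eq_one fun y hy => by
          obtain ⟨j, hj, rfl⟩ := List.mem_map.mp hy
          rw [if_neg]
          rintro rfl
          exact hL.1 hj
      rw [this, mul_one]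
    · rw [if_neg hhd, one_mul]
      have hj₀' : j₀ ∈ tl := by
        rcases List.mem_cons.mp hj₀ with h | h
        · exact absurd h.symm hhd
        · exact h
      exact ih hL.2 hj₀'

/-- **One ramified cusp, positive genus.** For `g ≥ 1`, a cusp `j₀` and `n`: a homomorphism
`Γ_{g,r} → H_n = (ℤ/n × ℤ/n) ⋊ ℤ/n` (Heisenberg group mod `n`), `a₁ ↦ x`, `b₁ ↦ y`, `c_{j₀} ↦ [x,y]⁻¹`
(central of order `n`), every other generator `↦ 1`: `c_{j₀}` has order exactly `n` and the other
cusps die. [cite: MochizukiSemiAnbd2006, Ex. 2.10 p.31] -/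
theorem exists_hom_single_cusp (hg : 0 < g) (j₀ : Fin r) (n : ℕ) :
    ∃ (σ : Multiplicative (ZMod n) →* MulAut (Multiplicative (ZMod n × ZMod n)))
      (f : PuncturedSurfaceGroup g r →*
        (Multiplicative (ZMod n × ZMod n) ⋊[σ] Multiplicative (ZMod n))),
      orderOf (f (c j₀)) = n ∧ ∀ j, j ≠ j₀ → f (c j) = 1 := by
  classical
  obtain ⟨g', rfl⟩ : ∃ g', g = g' + 1 := ⟨g - 1, by omega⟩
  let σ : Multiplicative (ZMod n) →* MulAut (Multiplicative (ZMod n × ZMod n)) :=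
    { toFun := fun t =>
        { toFun := fun q => ofAdd (q.toAdd.1, q.toAdd.2 + t.toAdd * q.toAdd.1)
          invFun := fun q => ofAdd (q.toAdd.1, q.toAdd.2 - t.toAdd * q.toAdd.1)
          left_inv := fun q => by simp
          right_inv := fun q => by simp
          map_mul' := fun q q' => by
            rw [← ofAdd_add, Prod.mk_add_mk, toAdd_mul, Prod.fst_add, Prod.snd_add]
            exact congrArg ofAdd (Prod.ext rfl (by dsimp only; ring)) }
      map_one' := by
        ext q
        · simp
        · simp
      map_mul' := fun t t' => by
        ext q
        · simp
        · simp only [toAdd_mul, MulAut.mul_apply, MulEquiv.coe_mk, Equiv.coe_fn_mk, toAdd_ofAdd]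
          ring }
  have hσ : ∀ (t : Multiplicative (ZMod n)) (a b : ZMod n),
      σ t (ofAdd (a, b)) = ofAdd (a, b + t.toAdd * a) := fun _ _ _ => rfl
  let x : Multiplicative (ZMod n × ZMod n) ⋊[σ] Multiplicative (ZMod n) :=
    SemidirectProduct.inr (ofAdd 1)
  let y : Multiplicative (ZMod n × ZMod n) ⋊[σ] Multiplicative (ZMod n) :=
    SemidirectProduct.inl (ofAdd (1, 0))
  let z : Multiplicative (ZMod n × ZMod n) ⋊[σ] Multiplicative (ZMod n) :=
    SemidirectProduct.inl (ofAdd (0, 1))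
  have hxyx : x * y * x⁻¹ = SemidirectProduct.inl (ofAdd ((1 : ZMod n), (1 : ZMod n))) := by
    rw [← map_inv, ← SemidirectProduct.inl_aut, hσ]
    simp
  have hz : x * y * x⁻¹ * y⁻¹ = z := by
    rw [hxyx, ← map_inv, ← map_mul, ← ofAdd_neg, ← ofAdd_add, Prod.neg_mk, Prod.mk_add_mk]
    simp [z]
  have hzord : orderOf z = n := by
    rw [orderOf_injective SemidirectProduct.inl SemidirectProduct.inl_injective,
      orderOf_ofAdd_eq_addOrderOf, Prod.addOrderOf, ZMod.addOrderOf_one, addOrderOf_zero,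
      Nat.lcm_one_left]
  let F : puncturedSurfaceGen (g' + 1) r →
      Multiplicative (ZMod n × ZMod n) ⋊[σ] Multiplicative (ZMod n) :=
    Sum.elim (fun ib => if ib.1 = 0 then (if ib.2 then y else x) else 1)
      fun j => if j = j₀ then z⁻¹ else 1
  have hx0 : F (Sum.inl (0, false)) = x := by simp [F]
  have hy0 : F (Sum.inl (0, true)) = y := by simp [F]
  have hrel : ∀ w ∈ ({relator (g' + 1) r} : Set (FreeGroup (puncturedSurfaceGen (g' + 1) r))),
      FreeGroup.lift F w = 1 := by
    intro w hw
    rw [Set.mem_singleton_iff] at hw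
    rw [hw, lift_relator]
    have h1 : ((List.finRange (g' + 1)).map fun i =>
        F (Sum.inl (i, false)) * F (Sum.inl (i, true)) * (F (Sum.inl (i, false)))⁻¹ *
          (F (Sum.inl (i, true)))⁻¹).prod = z := by
      rw [List.finRange_succ, List.map_cons, List.prod_cons, List.map_map]
      have htail : (List.map ((fun i : Fin (g' + 1) =>
          F (Sum.inl (i, false)) * F (Sum.inl (i, true)) * (F (Sum.inl (i, false)))⁻¹ *
            (F (Sum.inl (i, true)))⁻¹) ∘ Fin.succ) (List.finRange g')).prod = 1 :=
        List.prod_eq_one fun t ht => by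
          obtain ⟨i, -, rfl⟩ := List.mem_map.mp ht
          simp [F, Fin.succ_ne_zero i]
      rw [htail, mul_one, hx0, hy0]
      exact hz
    have h2 : ((List.finRange r).map fun j => F (Sum.inr j)).prod = z⁻¹ := by
      simp only [F, Sum.elim_inr]
      exact prod_map_ite_eq_of_nodup _ (List.nodup_finRange r) j₀ (List.mem_finRange j₀) z⁻¹
    rw [h1, h2, mul_inv_cancel]
  refine ⟨σ, PresentedGroup.toGroup hrel, ?_, fun j hj => ?_⟩
  · rw [c, PresentedGroup.toGroup.of]
    change orderOf (if j₀ = j₀ then z⁻¹ else 1) = n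
    rw [if_pos rfl, orderOf_inv, hzord]
  · rw [c, PresentedGroup.toGroup.of]
    change (if j = j₀ then z⁻¹ else 1) = 1
    rw [if_neg hj]

/-! ### The obstruction: on a sphere one cannot isolate a single cusp -/

/-- For `g = 0` the relation reads `c₁ c₂ ⋯ c_r = 1` in `Γ_{0,r}`. [cite: MochizukiSemiAnbd2006, Ex. 2.10 p.31] -/
theorem prod_c_eq_one_of_genus_zero :
    ((List.finRange r).map fun j => (c j : PuncturedSurfaceGroup 0 r)).prod = 1 := by
  have key : ((List.finRange r).map fun j => (c j : PuncturedSurfaceGroup 0 r)).prod =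
      PresentedGroup.mk ({relator 0 r} : Set (FreeGroup (puncturedSurfaceGen 0 r))) (relator 0 r) := by
    rw [show ((List.finRange r).map fun j => (c j : PuncturedSurfaceGroup 0 r)) =
        (List.finRange r).map (PresentedGroup.mk ({relator 0 r} : Set (FreeGroup (puncturedSurfaceGen 0 r)))
          ∘ fun j => genC (g := 0) j) from rfl, ← List.map_map, ← map_list_prod]
    congr 1
    rw [relator, List.finRange_zero, List.map_nil, List.prod_nil, one_mul]
  rw [key]
  exact PresentedGroup.one_of_mem (Set.mem_singleton _)

/-- **The genus-`0` obstruction.** If `g = 0`, a subgroup of `Γ_{0,r}` containing all the cusp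
generators but possibly `c_{j₀}` contains `c_{j₀}` as well (`c_{j₀}` is the inverse of the product of
the others): a covering of the sphere unramified outside one point is unramified.
[cite: MochizukiSemiAnbd2006, Ex. 2.10 p.31] -/
theorem mem_of_forall_ne_mem (H : Subgroup (PuncturedSurfaceGroup 0 r)) (j₀ : Fin r)
    (hH : ∀ j, j ≠ j₀ → c j ∈ H) : c j₀ ∈ H := by
  classical
  obtain ⟨s, t, hst⟩ := List.append_of_mem (List.mem_finRange j₀)
  have hnd : (s ++ j₀ :: t).Nodup := hst ▸ List.nodup_finRange r
  have hrel := prod_c_eq_one_of_genus_zero (r := r)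
  rw [hst, List.map_append, List.map_cons, List.prod_append, List.prod_cons] at hrel
  -- `c_{j₀} = (∏_s)⁻¹ (∏_t)⁻¹`
  have hs : (s.map fun j => (c j : PuncturedSurfaceGroup 0 r)).prod ∈ H :=
    Subgroup.list_prod_mem _ fun y hy => by
      obtain ⟨j, hj, rfl⟩ := List.mem_map.mp hy
      refine hH j ?_
      rintro rfl
      exact (List.nodup_append.mp hnd).2.2 j hj j (List.mem_cons_self) rfl
  have ht : (t.map fun j => (c j : PuncturedSurfaceGroup 0 r)).prod ∈ H :=
    Subgroup.list_prod_mem _ fun y hy => by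
      obtain ⟨j, hj, rfl⟩ := List.mem_map.mp hy
      refine hH j ?_
      rintro rfl
      exact ((List.nodup_cons.mp (List.nodup_append.mp hnd).2.1).1 hj).elim
  have hc : (c j₀ : PuncturedSurfaceGroup 0 r) =
      ((s.map fun j => (c j : PuncturedSurfaceGroup 0 r)).prod)⁻¹ *
        ((t.map fun j => (c j : PuncturedSurfaceGroup 0 r)).prod)⁻¹ := by
    exact eq_mul_inv_of_mul_eq (eq_inv_of_mul_eq_one_right hrel)
  rw [hc]
  exact H.mul_mem (H.inv_mem hs) (H.inv_mem ht)

/-- For `g = 0`, a subgroup containing ALL the cusp generators is everything.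
[cite: MochizukiSemiAnbd2006, Ex. 2.10 p.31] -/
theorem eq_top_of_forall_c_mem (H : Subgroup (PuncturedSurfaceGroup 0 r)) (hH : ∀ j, c j ∈ H) :
    H = ⊤ := by
  rw [eq_top_iff, ← PresentedGroup.closure_range_of, Subgroup.closure_le]
  rintro _ ⟨x, rfl⟩
  rcases x with ⟨i, _⟩ | j
  · exact i.elim0
  · exact hH j

/-! ### Assembly -/

/-- In `ℤ/n × ℤ/n`, an element one of whose coordinates is `± 1` has additive order exactly `n`.
[folklore] -/
private theorem addOrderOf_prod_eq {n : ℕ} [NeZero n] (a b : ZMod n)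
    (h : addOrderOf a = n ∨ addOrderOf b = n) : addOrderOf ((a, b) : ZMod n × ZMod n) = n := by
  rw [Prod.addOrderOf]
  have ha : addOrderOf a ∣ n := by
    have := addOrderOf_dvd_natCard a; rwa [Nat.card_zmod] at this
  have hb : addOrderOf b ∣ n := by
    have := addOrderOf_dvd_natCard b; rwa [Nat.card_zmod] at this
  rcases h with h | h
  · rw [h]; exact Nat.lcm_eq_left hb
  · rw [h]; exact Nat.lcm_eq_right ha

/-- **Mixed cusp-order quotients of `Γ_{g,r}`.** For `n ≥ 1` and disjoint sets of cusps `Z` (to be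
killed) and `R` (to have order exactly `n`), NOT in the obstructed position "`g = 0`, `R` a single
cusp, `Z ∪ R` everything", there is a normal subgroup `N ⊴ Γ_{g,r}` of index dividing `n ^ 3` with
`c_j ∈ N` for `j ∈ Z` and `N ∩ ⟨c_j⟩ = ⟨c_j ^ n⟩` for `j ∈ R`.
[cite: MochizukiSemiAnbd2006, Rem. 2.10.1 p.32] -/
theorem exists_normal_mixed {n : ℕ} (hn : 0 < n) (Z R : Finset (Fin r)) (hZR : Disjoint Z R)
    (hobs : ¬ (g = 0 ∧ R.card = 1 ∧ Z ∪ R = Finset.univ)) :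
    ∃ N : Subgroup (PuncturedSurfaceGroup g r), N.Normal ∧ N.index ∣ n ^ 3 ∧
      (∀ j ∈ Z, c j ∈ N) ∧ ∀ j ∈ R, N ⊓ cuspInertia j = Subgroup.zpowers (c j ^ n) := by
  classical
  haveI : NeZero n := ⟨hn.ne'⟩
  have hcardZ : Nat.card (Multiplicative (ZMod n)) = n := by
    rw [Nat.card_congr Multiplicative.toAdd, Nat.card_zmod]
  have hcardZ2 : Nat.card (Multiplicative (ZMod n × ZMod n)) = n ^ 2 := by
    rw [Nat.card_congr Multiplicative.toAdd, Nat.card_prod, Nat.card_zmod, sq]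
  -- the abelian construction for a set `R'` of at least two ramified cusps, killing everything else
  have habelian : ∀ R' : Finset (Fin r), Disjoint Z R' → 2 ≤ R'.card →
      ∃ N : Subgroup (PuncturedSurfaceGroup g r), N.Normal ∧ N.index ∣ n ^ 3 ∧
        (∀ j ∈ Z, c j ∈ N) ∧ ∀ j ∈ R', N ⊓ cuspInertia j = Subgroup.zpowers (c j ^ n) := by
    intro R' hZR' hR'
    obtain ⟨j₁, j₂, hj₁, hj₂, hne⟩ := Finset.one_lt_card_iff.mp hR'
    let k : ℕ := R'.card
    let w : Fin r → ZMod n × ZMod n := fun j =>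
      if j = j₁ then (-((k : ZMod n) - 1), -1) else if j = j₂ then (1, 1) else (1, 0)
    let v : Fin r → ZMod n × ZMod n := fun j => if j ∈ R' then w j else 0
    have hw_ord : ∀ j, addOrderOf (w j) = n := by
      intro j
      simp only [w]
      split_ifs
      · exact addOrderOf_prod_eq _ _ (Or.inr (by rw [addOrderOf_neg, ZMod.addOrderOf_one]))
      · exact addOrderOf_prod_eq _ _ (Or.inl (ZMod.addOrderOf_one n))
      · exact addOrderOf_prod_eq _ _ (Or.inl (ZMod.addOrderOf_one n))
    have hsum : ∑ j, v j = 0 := by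
      have h1 : ∑ j, v j = ∑ j ∈ R', w j := by
        rw [← Finset.sum_filter_add_sum_filter_not Finset.univ (· ∈ R')]
        have ha : ∑ j ∈ Finset.univ.filter (· ∈ R'), v j = ∑ j ∈ R', w j := by
          rw [Finset.filter_mem_eq_inter, Finset.univ_inter]
          exact Finset.sum_congr rfl fun j hj => by simp only [v, if_pos hj]
        have hb : ∑ j ∈ Finset.univ.filter (fun j => ¬ j ∈ R'), v j = 0 :=
          Finset.sum_eq_zero fun j hj => by
            simp only [Finset.mem_filter, Finset.mem_univ, true_and] at hj
            simp only [v, if_neg hj]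
        rw [ha, hb, add_zero]
      rw [h1, ← Finset.add_sum_erase R' w hj₁,
        ← Finset.add_sum_erase (R'.erase j₁) w (Finset.mem_erase.mpr ⟨hne.symm, hj₂⟩)]
      have hrest : ∑ j ∈ (R'.erase j₁).erase j₂, w j = (k - 2) • ((1, 0) : ZMod n × ZMod n) := by
        rw [Finset.sum_congr rfl (g := fun _ => ((1, 0) : ZMod n × ZMod n)) fun j hj => by
          simp only [Finset.mem_erase] at hj
          simp only [w, if_neg hj.2.1, if_neg hj.1]]
        rw [Finset.sum_const, Finset.card_erase_of_mem (Finset.mem_erase.mpr ⟨hne.symm, hj₂⟩),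
          Finset.card_erase_of_mem hj₁]
        rfl
      have hw1 : w j₁ = (-((k : ZMod n) - 1), -1) := if_pos rfl
      have hw2 : w j₂ = (1, 1) := by
        show (if j₂ = j₁ then _ else if j₂ = j₂ then _ else _) = _
        rw [if_neg hne.symm, if_pos rfl]
      rw [hrest, hw1, hw2]
      have hk2 : 2 ≤ k := hR'
      refine Prod.ext ?_ ?_
      · show -((k : ZMod n) - 1) + (1 + (k - 2) • (1 : ZMod n)) = 0
        rw [nsmul_eq_mul, mul_one, Nat.cast_sub hk2, Nat.cast_two]; ring
      · show (-1 : ZMod n) + (1 + (k - 2) • (0 : ZMod n)) = 0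
        rw [smul_zero, add_zero, neg_add_cancel]
    obtain ⟨φ, hφ⟩ := exists_hom_of_values (g := g) v hsum
    refine ⟨φ.ker, inferInstance, ?_, fun j hj => ?_, fun j hj => ?_⟩
    · exact (index_ker_dvd_card φ).trans (by rw [hcardZ2]; exact pow_dvd_pow n (by norm_num))
    · rw [MonoidHom.mem_ker, hφ]
      simp only [v, if_neg (Finset.disjoint_left.mp hZR' hj), ofAdd_zero]
    · refine ker_inf_cuspInertia_eq φ j ?_
      rw [hφ, orderOf_ofAdd_eq_addOrderOf]
      simp only [v, if_pos hj]
      exact hw_ord j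
  -- case analysis on the number of ramified cusps
  rcases Nat.lt_or_ge R.card 2 with hlt | hge
  · rcases Nat.lt_or_ge R.card 1 with h0 | h1
    · -- no ramified cusp: `N = Γ`
      have hR0 : R = ∅ := Finset.card_eq_zero.mp (by omega)
      refine ⟨⊤, inferInstance, by simp, fun j _ => Subgroup.mem_top _, fun j hj => ?_⟩
      rw [hR0] at hj; simp at hj
    · -- exactly one ramified cusp `j₀`
      have hR1 : R.card = 1 := by omega
      obtain ⟨j₀, hRj₀⟩ := Finset.card_eq_one.mp hR1
      by_cases hg : g = 0
      · -- genus 0: use a free cusp `u ∉ Z ∪ R` as a second ramified cusp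
        have hne : Z ∪ R ≠ Finset.univ := fun h => hobs ⟨hg, hR1, h⟩
        obtain ⟨u, -, hu⟩ := Finset.exists_mem_notMem_of_card_lt_card
          (Finset.card_lt_card ((Finset.subset_univ (Z ∪ R)).lt_of_ne hne))
        rw [Finset.mem_union, not_or] at hu
        have huj : u ≠ j₀ := by rintro rfl; exact hu.2 (hRj₀ ▸ Finset.mem_singleton_self _)
        obtain ⟨N, hN, hidx, hZ, hR'⟩ := habelian (insert u R)
          (Finset.disjoint_insert_right.mpr ⟨hu.1, hZR⟩)
          (by rw [Finset.card_insert_of_notMem hu.2, hR1])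
        exact ⟨N, hN, hidx, hZ, fun j hj => hR' j (Finset.mem_insert_of_mem hj)⟩
      · -- positive genus: Heisenberg quotient
        have hg' : 0 < g := Nat.pos_of_ne_zero hg
        obtain ⟨σ, f, hford, hfone⟩ := exists_hom_single_cusp (r := r) hg' j₀ n
        haveI : Finite (Multiplicative (ZMod n × ZMod n) ⋊[σ] Multiplicative (ZMod n)) :=
          Finite.of_equiv _ SemidirectProduct.equivProd.symm
        refine ⟨f.ker, inferInstance, ?_, fun j hj => ?_, fun j hj => ?_⟩
        · refine (index_ker_dvd_card f).trans (dvd_of_eq ?_)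
          rw [Nat.card_congr SemidirectProduct.equivProd, Nat.card_prod, hcardZ2, hcardZ]
          ring
        · rw [MonoidHom.mem_ker]
          refine hfone j ?_
          rintro rfl
          exact Finset.disjoint_left.mp hZR hj (hRj₀ ▸ Finset.mem_singleton_self _)
        · rw [hRj₀, Finset.mem_singleton] at hj
          subst hj
          exact ker_inf_cuspInertia_eq f j hford
  · exact habelian R hZR hge

end Literature.GroupTheory.CombinatorialGroupTheory.PuncturedSurfaceGroup
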